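import Summits.CriticalPhenomena.PercolationContinuityZ3.Theorems.PercNearOneGluingNoHeavyQuantDIBStarFloorSplitInductionBig
import Summits.CriticalPhenomena.PercolationContinuityZ3.Theorems.PercNearOneGluingNoHeavyQuantRootDecPartnerLemma
import HarnessLib

/-!
# QUANT lane R8, Conjecture DIB\* — CONJECTURE FS-E TYPED (the induction-free floor split with CLOSED-FORM certificates) and the bridge
# `FSE → StepLemmaFSBig → ∀ x < 1, DIBStar x`

builds on p205010 (kernel theorem, internal audit signed; external expert review pending)

Statement + support file (`--supports stmt-CriticalPhenomena-4575`), QUANT lane lead (gen 17); memo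
`run/shared/lean/prim/quant/prim-quant-lead-g17/LEAD-NOTES-G17.md` N33 (4) and addenda.  TWO `Prop` definitions (`RootDec.CertFS` = the closed-form certificate
menu, and the `@[conjecture]` `IndepBlob.FSE`), theorems otherwise; no sorries, standard axioms.

THE MENU.  For a system `(a, g)` with sure part `s` at layer `j`, `CertFS a g j s z` says that ONE of the five closed-form TERM rules certifies `z ≤ TERM[s, a, g, j]`:
trivial (`z ≤ 0`) · ∨ disjunction of giants (`term_ge_disj_giants`, p258645) · ∧ one witness set (`prod_le_term_of_witness`, p258645; a heavy giant is the singleton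
case) · α′ size row at a floor `≥ 1/2` (`term_ge_of_extraBlobs`, typer g17) · ε Cantelli (`term_ge_of_cantelli`, typer g17).  `term_ge_of_certFS` is the soundness.
CONJECTURE FS-E (`IndepBlob.FSE`): every hard instance of the narrowed class (`StepLemmaFSBig`'s hypotheses WITHOUT the inductive one) admits a blob `k` and floors
`z₁, z₀` with `x ≤ g k·z₁ + (1 − g k)·z₀`, the open branch (`a[k↦0]`, sure part `a k`) certified at `z₁` and the closed branch (`a[k↦0]`, sure part `0`) at `z₀` by
the menu.  EVIDENCE (lead g17; k = a blob of MAXIMAL size always worked): kit j128353 219 775 and j128354 2 878 508 exact hard instances / 0 failures; adversarial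
search j128590 (16 × 90 climbs × 4 000 moves, j ≤ 9, ≤ 10 blobs) 0 failures, minimum normalised margin 0.068; the cruder 'whole-system Cantelli OR pair witnesses'
is FALSE (8 adversarial hits — Cantelli is needed on the open branch).  `stepLemmaFSBig_of_fse` + lead g17's induction give **`dibStar_of_fse : FSE → ∀ x < 1, DIBStar x`**:
a proof of the closed-form ∀∃ statement FS-E closes T-DIB with no further kernel work.  NOT PROVED here: `FSE`.
[this work]; the gluing rows served [cite: KozmaNitzan2024, Conjecture 3 (p. 15)]; product weights [cite: Grimmett1999, §1.3 p. 10].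
-/

namespace Summit.CriticalPhenomena.PercolationContinuityZ3.Theorems

namespace Quant

open Finset

namespace RootDec

variable {κ : Type} [Fintype κ] [DecidableEq κ]

/-- product-Bernoulli weight of the set `W` of open blobs (as in `…QuantRootReduction`) -/
local notation3 "wt[" g ", " W "]" => ∏ k, (if k ∈ (W : Finset κ) then (g : κ → ℝ) k else 1 - (g : κ → ℝ) k)

/-- the TERM tail `P(s + Σ_{k open} a k ≥ j+1)` (as in `…QuantRootReduction`) -/
local notation3 "TERM[" s ", " a ", " g ", " j "]" =>
  ∑ W : Finset κ, wt[g, W] * (if (j : ℕ) + 1 ≤ (s : ℕ) + ∑ k ∈ W, (a : κ → ℕ) k then (1 : ℝ) else 0)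

/-- **The closed-form certificate menu of ARCHITECTURE FS** for `z ≤ TERM[s, a, g, j]`: trivial | ∨ (some finset of giants, `z ≤ 1 − ∏(1 − g)`) |
∧ (some finset reaching the target, `z ≤ ∏ g`) | α′ (at some floor `z' ≥ max(z, 1/2)`, `z' ≤ 1`, the blobs with gate `≥ z'` total `≥ 2(j − s) + 1`) | ε (Cantelli with the exact mean and
variance).  Every disjunct is a closed-form inequality in the instance data. [this work] -/
def CertFS (a : κ → ℕ) (g : κ → ℝ) (j s : ℕ) (z : ℝ) : Prop :=
  z ≤ 0 ∨
  (∃ G : Finset κ, (∀ k ∈ G, j + 1 ≤ s + a k) ∧ z ≤ 1 - ∏ k ∈ G, (1 - g k)) ∨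
  (∃ S : Finset κ, j + 1 ≤ s + ∑ k ∈ S, a k ∧ z ≤ ∏ k ∈ S, g k) ∨
  (∃ z' : ℝ, z ≤ z' ∧ 1 / 2 ≤ z' ∧ z' ≤ 1 ∧ 2 * (j - s) + 1 ≤ ∑ k ∈ Finset.univ.filter (fun k => z' ≤ g k), a k) ∨
  (s ≤ j ∧ ((j - s : ℕ) : ℝ) < ∑ k, (a k : ℝ) * g k ∧
    z ≤ 1 - (∑ k, (a k : ℝ) ^ 2 * g k * (1 - g k)) /
      ((∑ k, (a k : ℝ) ^ 2 * g k * (1 - g k)) + ((∑ k, (a k : ℝ) * g k) - ((j - s : ℕ) : ℝ)) ^ 2))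

/-- **Soundness of the menu**: gates in `[0,1]` and `CertFS a g j s z` ⟹ `z ≤ TERM[s, a, g, j]`. [this work] -/
theorem term_ge_of_certFS (a : κ → ℕ) (g : κ → ℝ) (j s : ℕ) (z : ℝ)
    (hg : ∀ k, 0 ≤ g k ∧ g k ≤ 1) (hc : CertFS a g j s z) : z ≤ TERM[s, a, g, j] := by
  rcases hc with h0 | ⟨G, hG, hz⟩ | ⟨S, hS, hz⟩ | ⟨z', hzz', hhalf, h1, hsize⟩ | ⟨hs, hm, hz⟩
  · exact h0.trans (term_nonneg s a g j hg)
  · exact hz.trans (term_ge_disj_giants s a g j hg G hG)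
  · exact hz.trans (prod_le_term_of_witness s a g j hg S hS)
  · exact hzz'.trans (term_ge_of_extraBlobs s a g j z' hhalf h1 hg hsize)
  · exact hz.trans (term_ge_of_cantelli s a g j hg hs hm)

end RootDec

namespace IndepBlob

open Finset

/-- **CONJECTURE FS-E (lead g17) — the induction-free floor split with closed-form certificates.**  For every hard instance of the narrowed class
(floor `1/2 < x < 1`, gates in `[0,1]`, light sizes `≤ j`, heavy total `≤ 2j`, no heavy giant, two distinct non-empty light blobs, light total `≥ j + 1`, credit
`> 2j`) there are a blob `k` and reals `z₁, z₀` with `x ≤ g k·z₁ + (1 − g k)·z₀` such that the OPEN branch (`a[k ↦ 0]`, sure part `a k`) is menu-certified at `z₁`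
and the CLOSED branch (`a[k ↦ 0]`, sure part `0`) at `z₀` (`RootDec.CertFS`).  Evidence: see the module docstring (3.1 M exact + adversarial, 0 failures with `k` of
maximal size).  builds on p205010 (kernel theorem, internal audit signed; external expert review pending). [this work] [status: open] -/
@[conjecture] def FSE : Prop :=
  ∀ (κ : Type) [Fintype κ] [DecidableEq κ] (a : κ → ℕ) (g : κ → ℝ) (j : ℕ) (x : ℝ),
    1 / 2 < x → x < 1 →
    (∀ k, 0 ≤ g k ∧ g k ≤ 1) →
    (∀ k, g k < x → a k ≤ j) →
    (∑ k ∈ Finset.univ.filter (fun k => x ≤ g k), a k ≤ 2 * j) →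
    (∀ k, x ≤ g k → a k ≤ j) →
    (∃ k₁ k₂, k₁ ≠ k₂ ∧ g k₁ < x ∧ 0 < a k₁ ∧ g k₂ < x ∧ 0 < a k₂) →
    (j + 1 ≤ ∑ k ∈ Finset.univ.filter (fun k => g k < x), a k) →
    (2 * j : ℝ) < ∑ k, (a k : ℝ) * (if x ≤ g k then g k else (g k - x ^ 2) / (1 - x)) →
    ∃ k : κ, ∃ z₁ z₀ : ℝ, x ≤ g k * z₁ + (1 - g k) * z₀ ∧
      RootDec.CertFS (Function.update a k 0) g j (a k) z₁ ∧ RootDec.CertFS (Function.update a k 0) g j 0 z₀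

/-- **FS-E implies the step lemma** (rule φ `term_ge_of_floorSplit` + `term_ge_of_certFS` on both branches; the inductive hypothesis is not even used). [this work] -/
theorem stepLemmaFSBig_of_fse (H : FSE) : StepLemmaFSBig := by
  intro κ _ _ a g j x hx hx1 hg hlight hcorner hnogiant htwo hbig hcredit _
  obtain ⟨k, z₁, z₀, hxz, c₁, c₀⟩ := H κ a g j x hx hx1 hg hlight hcorner hnogiant htwo hbig hcredit
  have h₁ := RootDec.term_ge_of_certFS (Function.update a k 0) g j (a k) z₁ hg c₁
  have h₀ := RootDec.term_ge_of_certFS (Function.update a k 0) g j 0 z₀ hg c₀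
  have h₁' : z₁ ≤ ∑ W : Finset κ, (∏ k', if k' ∈ W then g k' else 1 - g k') *
      (if j + 1 ≤ (0 + a k) + ∑ k' ∈ W, Function.update a k 0 k' then (1 : ℝ) else 0) := by
    rw [zero_add]; exact h₁
  have key := RootDec.term_ge_of_floorSplit 0 a g j k x z₁ z₀ (hg k) h₁' h₀ hxz
  exact key.trans (le_of_eq (Finset.sum_congr rfl fun W _ => by rw [zero_add]))

/-- **`FSE ⟹ DIB\*` at every floor `x < 1`** — so a proof of the closed-form conjecture FS-E closes T-DIB. [this work] -/
theorem dibStar_of_fse (H : FSE) (x : ℝ) (hx1 : x < 1) : DIBStar x :=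
  dibStar_of_stepLemmaFSBig (stepLemmaFSBig_of_fse H) x hx1

end IndepBlob

end Quant

end Summit.CriticalPhenomena.PercolationContinuityZ3.Theorems
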